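import Mathlib
import HarnessLib
import Summits.ResolutionOfSingularities.ResolutionOfSingularities.Theorems.WildQuotientsWildQuotientResolutionJordanFiveFrameDefs
import Summits.ResolutionOfSingularities.ResolutionOfSingularities.Theorems.WildQuotientsWildQuotientResolutionPrincipalChartRees
import Literature.AlgebraicGeometry.Resolution.AffineBlowupRegular

/-!
# RUNG V5 (`J₅`): the four VERTEX charts `V[x_a³]`, `V[x_b⁴]`, `V[x_c⁶]`, `V[x_d¹²]` cover `Bl_{I₁₂} 𝔸ⁿ`
(crux stmt-ResolutionOfSingularities-15640 `WildQuotients.WildQuotientResolution`, line `Sketch`;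
chain w45c RUNG V5 `JordanFive.jordanFive_hasResolution_of_bricks`, brick **`Hcov`** step 1
(res-L1-w45c-plan-1 RULING 10:50Z «stub-5 = (δ1) W-SIDE PACKAGE … + Hcov»); written by
res-D-pv-033 AS res-L1-w45c-stub-5. [OURS · L1 W4.5c] — elementary Rees-algebra bookkeeping over
res-L1-w45c-lead-1's `JordanFive.gens12`/`I12`/`chart` (p523816); NOT a statement of any manuscript.)

For the 40 minimal monomials `gens12` of `(4,3,2,1)`-weight `≥ 12` every Rees chart `D₊(g_j t)`
lies in one of the four vertex charts: each non-vertex generator satisfies an explicit identity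
`g_j² = v · g_k (· x)` or `g_j³ = v · g_k · g_l` with `v ∈ {x_a³, x_b⁴, x_c⁶, x_d¹²}` (36 two-line
certificates; generic lemmas `basicOpen_reesT_le_of_sq_eq` / `_of_cube_eq`: `(g t)ᵐ ∈ (v t)` ⇒
`D₊(g t) ⊆ D₊(v t)`). With GW (13.19) (the `D₊(g_j t)` cover, tree
`reesT_mem_span_range_reesT` / `Proj.iSup_basicOpen_eq_top`):
* `JordanFive.exists_vertex_basicOpen_le` — `∀ j, ∃ i ∈ {0,1,2,3}, D₊(g_j t) ⊆ D₊(g_i t)`;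
* `JordanFive.iSup_vertexBasicOpen_eq_top` — `D₊(x_a³t) ∪ D₊(x_b⁴t) ∪ D₊(x_c⁶t) ∪ D₊(x_d¹²t) = Bl`;
* `JordanFive.chart_eq_basicOpen` — lead-1's `chart j = V[g_j]` IS `D₊(g_j t)` (p506419 bridge);
* `JordanFive.iSup_vertexCharts_eq_top` — **`chart 0 ⊔ chart 1 ⊔ chart 2 ⊔ chart 3 = ⊤`**.
The scaffold's `Hcov : chart 0 ⊔ W₁ ⊔ W₂ ⊔ chart 3 = ⊤` then reduces to `chart 1 ⊆ chart 0 ∪ W₁ ∪ …`,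
`chart 2 ⊆ … ∪ W₂ ∪ chart 3` once the W-terms are fixed (step 2).
-/

-- single-problem summit: the doubled namespace component `ResolutionOfSingularities` is forced
set_option linter.dupNamespace false

noncomputable section

open CategoryTheory AlgebraicGeometry TopologicalSpace MvPolynomial Polynomial
open Literature.AlgebraicGeometry.Resolution

namespace Summit.ResolutionOfSingularities.ResolutionOfSingularities.Theorems.WildQuotientResolution.JordanFive

universe u

/-! ## Generic: `(g t)ᵐ ∈ (v t)` ⇒ `D₊(g t) ⊆ D₊(v t)` -/

section Generic

variable {R : Type u} [CommRing R] {I : Ideal R}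

/-- If `b² = v · r` with `v, r ∈ I` then `D₊(b t) ⊆ D₊(v t)` in `Bl_I(Spec R)` (`(bt)² = (vt)(rt)`).
[folklore] -/
theorem basicOpen_reesT_le_of_sq_eq (b v r : R) (hb : b ∈ I) (hv : v ∈ I) (hr : r ∈ I)
    (h : b ^ 2 = v * r) :
    Proj.basicOpen (reesGrading I) (reesT b hb) ≤ Proj.basicOpen (reesGrading I) (reesT v hv) := by
  have key : reesT b hb ^ 2 = reesT v hv * reesT r hr := by
    apply Subtype.ext
    change (reesT b hb : R[X]) ^ 2 = (reesT v hv : R[X]) * (reesT r hr : R[X])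
    rw [coe_reesT, coe_reesT, coe_reesT, Polynomial.monomial_pow, Polynomial.monomial_mul_monomial, h]
  rw [← Proj.basicOpen_pow _ _ 2 two_pos, key, Proj.basicOpen_mul]
  exact inf_le_left

/-- If `b³ = v · r · s` with `v, r, s ∈ I` then `D₊(b t) ⊆ D₊(v t)` (`(bt)³ = (vt)(rt)(st)`).
[folklore] -/
theorem basicOpen_reesT_le_of_cube_eq (b v r s : R) (hb : b ∈ I) (hv : v ∈ I) (hr : r ∈ I)
    (hs : s ∈ I) (h : b ^ 3 = v * r * s) :
    Proj.basicOpen (reesGrading I) (reesT b hb) ≤ Proj.basicOpen (reesGrading I) (reesT v hv) := by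
  have key : reesT b hb ^ 3 = reesT v hv * reesT r hr * reesT s hs := by
    apply Subtype.ext
    change (reesT b hb : R[X]) ^ 3 =
      (reesT v hv : R[X]) * (reesT r hr : R[X]) * (reesT s hs : R[X])
    rw [coe_reesT, coe_reesT, coe_reesT, coe_reesT, Polynomial.monomial_pow, Polynomial.monomial_mul_monomial,
      Polynomial.monomial_mul_monomial, h]
  rw [← Proj.basicOpen_pow _ _ 3 three_pos, key, Proj.basicOpen_mul, Proj.basicOpen_mul]
  exact inf_le_left.trans inf_le_left

end Generic

/-! ## The 36 certificates and the vertex cover -/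

variable (k : Type) [Field k] (n : ℕ) (a b c d : Fin n)

-- 40 cases, each a two-line certificate
set_option maxHeartbeats 2000000 in
/-- **Every Rees chart of `Bl_{I₁₂} 𝔸ⁿ` lies in a vertex chart**: for each of the 40 generators
`g_j` there is a vertex `i ∈ {0,1,2,3}` (`x_a³, x_b⁴, x_c⁶, x_d¹²`) with `D₊(g_j t) ⊆ D₊(g_i t)`.
[OURS · L1 W4.5c] [folklore; 36 monomial certificates] -/
theorem exists_vertex_basicOpen_le (j : Fin 40) :
    ∃ i : Fin 40, (i = 0 ∨ i = 1 ∨ i = 2 ∨ i = 3) ∧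
      Proj.basicOpen (reesGrading (I12 k n a b c d))
          (reesT (gens12 k n a b c d j) (gens12_mem_I12 k n a b c d j)) ≤
        Proj.basicOpen (reesGrading (I12 k n a b c d))
          (reesT (gens12 k n a b c d i) (gens12_mem_I12 k n a b c d i)) := by
  fin_cases j
  · exact ⟨0, by decide, le_rfl⟩
  · exact ⟨1, by decide, le_rfl⟩
  · exact ⟨2, by decide, le_rfl⟩
  · exact ⟨3, by decide, le_rfl⟩
  · exact ⟨0, by decide, basicOpen_reesT_le_of_sq_eq _ _ (gens12 k n a b c d 9) (gens12_mem_I12 k n a b c d 4) (gens12_mem_I12 k n a b c d 0)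
      (gens12_mem_I12 k n a b c d 9) (by simp only [gens12, Matrix.cons_val]; ring)⟩
  · exact ⟨0, by decide, basicOpen_reesT_le_of_sq_eq _ _ (gens12 k n a b c d 13) (gens12_mem_I12 k n a b c d 5) (gens12_mem_I12 k n a b c d 0)
      (gens12_mem_I12 k n a b c d 13) (by simp only [gens12, Matrix.cons_val]; ring)⟩
  · exact ⟨0, by decide, basicOpen_reesT_le_of_sq_eq _ _ (gens12 k n a b c d 15) (gens12_mem_I12 k n a b c d 6) (gens12_mem_I12 k n a b c d 0)
      (gens12_mem_I12 k n a b c d 15) (by simp only [gens12, Matrix.cons_val]; ring)⟩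
  · exact ⟨0, by decide, basicOpen_reesT_le_of_sq_eq _ _ (gens12 k n a b c d 17) (gens12_mem_I12 k n a b c d 7) (gens12_mem_I12 k n a b c d 0)
      (gens12_mem_I12 k n a b c d 17) (by simp only [gens12, Matrix.cons_val]; ring)⟩
  · exact ⟨1, by decide, basicOpen_reesT_le_of_sq_eq _ _ (gens12 k n a b c d 5) (gens12_mem_I12 k n a b c d 8) (gens12_mem_I12 k n a b c d 1)
      (gens12_mem_I12 k n a b c d 5) (by simp only [gens12, Matrix.cons_val]; ring)⟩
  · exact ⟨1, by decide, basicOpen_reesT_le_of_sq_eq _ _ (gens12 k n a b c d 7) (gens12_mem_I12 k n a b c d 9) (gens12_mem_I12 k n a b c d 1)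
      (gens12_mem_I12 k n a b c d 7) (by simp only [gens12, Matrix.cons_val]; ring)⟩
  · exact ⟨0, by decide, basicOpen_reesT_le_of_cube_eq _ _ (gens12 k n a b c d 2) (gens12 k n a b c d 19) (gens12_mem_I12 k n a b c d 10)
      (gens12_mem_I12 k n a b c d 0) (gens12_mem_I12 k n a b c d 2) (gens12_mem_I12 k n a b c d 19) (by simp only [gens12, Matrix.cons_val]; ring)⟩
  · exact ⟨0, by decide, basicOpen_reesT_le_of_cube_eq _ _ (gens12 k n a b c d 18) (gens12 k n a b c d 32) (gens12_mem_I12 k n a b c d 11)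
      (gens12_mem_I12 k n a b c d 0) (gens12_mem_I12 k n a b c d 18) (gens12_mem_I12 k n a b c d 32) (by simp only [gens12, Matrix.cons_val]; ring)⟩
  · exact ⟨0, by decide, basicOpen_reesT_le_of_cube_eq _ _ (gens12 k n a b c d 3) (gens12 k n a b c d 19) (gens12_mem_I12 k n a b c d 12)
      (gens12_mem_I12 k n a b c d 0) (gens12_mem_I12 k n a b c d 3) (gens12_mem_I12 k n a b c d 19) (by simp only [gens12, Matrix.cons_val]; ring)⟩
  · exact ⟨2, by decide, basicOpen_reesT_le_of_sq_eq _ _ (gens12 k n a b c d 5) (gens12_mem_I12 k n a b c d 13) (gens12_mem_I12 k n a b c d 2)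
      (gens12_mem_I12 k n a b c d 5) (by simp only [gens12, Matrix.cons_val]; ring)⟩
  · exact ⟨2, by decide, basicOpen_reesT_le_of_sq_eq _ _ (gens12 k n a b c d 7) (gens12_mem_I12 k n a b c d 14) (gens12_mem_I12 k n a b c d 2)
      (gens12_mem_I12 k n a b c d 7) (by simp only [gens12, Matrix.cons_val]; ring)⟩
  · exact ⟨0, by decide, basicOpen_reesT_le_of_cube_eq _ _ (gens12 k n a b c d 2) (gens12 k n a b c d 3) (gens12_mem_I12 k n a b c d 15)
      (gens12_mem_I12 k n a b c d 0) (gens12_mem_I12 k n a b c d 2) (gens12_mem_I12 k n a b c d 3) (by simp only [gens12, Matrix.cons_val]; ring)⟩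
  · exact ⟨3, by decide, basicOpen_reesT_le_of_sq_eq _ _ (gens12 k n a b c d 5) (gens12_mem_I12 k n a b c d 16) (gens12_mem_I12 k n a b c d 3)
      (gens12_mem_I12 k n a b c d 5) (by simp only [gens12, Matrix.cons_val]; ring)⟩
  · exact ⟨3, by decide, basicOpen_reesT_le_of_sq_eq _ _ (gens12 k n a b c d 7) (gens12_mem_I12 k n a b c d 17) (gens12_mem_I12 k n a b c d 3)
      (gens12_mem_I12 k n a b c d 7) (by simp only [gens12, Matrix.cons_val]; ring)⟩
  · exact ⟨1, by decide, basicOpen_reesT_le_of_sq_eq _ _ (gens12 k n a b c d 21) (gens12_mem_I12 k n a b c d 18) (gens12_mem_I12 k n a b c d 1)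
      (gens12_mem_I12 k n a b c d 21) (by simp only [gens12, Matrix.cons_val]; ring)⟩
  · exact ⟨1, by decide, basicOpen_reesT_le_of_sq_eq _ _ (gens12 k n a b c d 23) (gens12_mem_I12 k n a b c d 19) (gens12_mem_I12 k n a b c d 1)
      (gens12_mem_I12 k n a b c d 23) (by simp only [gens12, Matrix.cons_val]; ring)⟩
  · exact ⟨1, by decide, basicOpen_reesT_le_of_sq_eq _ _ (gens12 k n a b c d 2) (gens12_mem_I12 k n a b c d 20) (gens12_mem_I12 k n a b c d 1)
      (gens12_mem_I12 k n a b c d 2) (by simp only [gens12, Matrix.cons_val]; ring)⟩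
  · exact ⟨1, by decide, basicOpen_reesT_le_of_sq_eq _ _ (gens12 k n a b c d 30) (gens12_mem_I12 k n a b c d 21) (gens12_mem_I12 k n a b c d 1)
      (gens12_mem_I12 k n a b c d 30) (by simp only [gens12, Matrix.cons_val]; ring)⟩
  · exact ⟨1, by decide, basicOpen_reesT_le_of_sq_eq _ _ (gens12 k n a b c d 32) (gens12_mem_I12 k n a b c d 22) (gens12_mem_I12 k n a b c d 1)
      (gens12_mem_I12 k n a b c d 32) (by simp only [gens12, Matrix.cons_val]; ring)⟩
  · exact ⟨1, by decide, basicOpen_reesT_le_of_sq_eq _ _ (gens12 k n a b c d 3) (gens12_mem_I12 k n a b c d 23) (gens12_mem_I12 k n a b c d 1)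
      (gens12_mem_I12 k n a b c d 3) (by simp only [gens12, Matrix.cons_val]; ring)⟩
  · exact ⟨2, by decide, basicOpen_reesT_le_of_sq_eq _ _ (gens12 k n a b c d 21) (gens12_mem_I12 k n a b c d 24) (gens12_mem_I12 k n a b c d 2)
      (gens12_mem_I12 k n a b c d 21) (by simp only [gens12, Matrix.cons_val]; ring)⟩
  · exact ⟨2, by decide, basicOpen_reesT_le_of_sq_eq _ _ (gens12 k n a b c d 23) (gens12_mem_I12 k n a b c d 25) (gens12_mem_I12 k n a b c d 2)
      (gens12_mem_I12 k n a b c d 23) (by simp only [gens12, Matrix.cons_val]; ring)⟩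
  · exact ⟨2, by decide, basicOpen_reesT_le_of_cube_eq _ _ (gens12 k n a b c d 3) (gens12 k n a b c d 19) (gens12_mem_I12 k n a b c d 26)
      (gens12_mem_I12 k n a b c d 2) (gens12_mem_I12 k n a b c d 3) (gens12_mem_I12 k n a b c d 19) (by simp only [gens12, Matrix.cons_val]; ring)⟩
  · exact ⟨3, by decide, basicOpen_reesT_le_of_sq_eq _ _ (gens12 k n a b c d 21) (gens12_mem_I12 k n a b c d 27) (gens12_mem_I12 k n a b c d 3)
      (gens12_mem_I12 k n a b c d 21) (by simp only [gens12, Matrix.cons_val]; ring)⟩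
  · exact ⟨3, by decide, basicOpen_reesT_le_of_sq_eq _ _ (gens12 k n a b c d 23) (gens12_mem_I12 k n a b c d 28) (gens12_mem_I12 k n a b c d 3)
      (gens12_mem_I12 k n a b c d 23) (by simp only [gens12, Matrix.cons_val]; ring)⟩
  · exact ⟨2, by decide, basicOpen_reesT_le_of_sq_eq _ _ (gens12 k n a b c d 30) (gens12_mem_I12 k n a b c d 29) (gens12_mem_I12 k n a b c d 2)
      (gens12_mem_I12 k n a b c d 30) (by simp only [gens12, Matrix.cons_val]; ring)⟩
  · exact ⟨2, by decide, basicOpen_reesT_le_of_sq_eq _ _ (gens12 k n a b c d 32) (gens12_mem_I12 k n a b c d 30) (gens12_mem_I12 k n a b c d 2)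
      (gens12_mem_I12 k n a b c d 32) (by simp only [gens12, Matrix.cons_val]; ring)⟩
  · exact ⟨2, by decide, basicOpen_reesT_le_of_sq_eq _ _ (gens12 k n a b c d 3) (gens12_mem_I12 k n a b c d 31) (gens12_mem_I12 k n a b c d 2)
      (gens12_mem_I12 k n a b c d 3) (by simp only [gens12, Matrix.cons_val]; ring)⟩
  · exact ⟨3, by decide, basicOpen_reesT_le_of_sq_eq _ _ (gens12 k n a b c d 30) (gens12_mem_I12 k n a b c d 32) (gens12_mem_I12 k n a b c d 3)
      (gens12_mem_I12 k n a b c d 30) (by simp only [gens12, Matrix.cons_val]; ring)⟩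
  · exact ⟨3, by decide, basicOpen_reesT_le_of_sq_eq _ _ (gens12 k n a b c d 32) (gens12_mem_I12 k n a b c d 33) (gens12_mem_I12 k n a b c d 3)
      (gens12_mem_I12 k n a b c d 32) (by simp only [gens12, Matrix.cons_val]; ring)⟩
  · exact ⟨0, by decide, basicOpen_reesT_le_of_sq_eq _ _ (gens12 k n a b c d 8 * X c) (gens12_mem_I12 k n a b c d 34) (gens12_mem_I12 k n a b c d 0)
      (Ideal.mul_mem_right _ _ (gens12_mem_I12 k n a b c d 8)) (by simp only [gens12, Matrix.cons_val]; ring)⟩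
  · exact ⟨1, by decide, basicOpen_reesT_le_of_sq_eq _ _ (gens12 k n a b c d 39) (gens12_mem_I12 k n a b c d 35) (gens12_mem_I12 k n a b c d 1)
      (gens12_mem_I12 k n a b c d 39) (by simp only [gens12, Matrix.cons_val]; ring)⟩
  · exact ⟨2, by decide, basicOpen_reesT_le_of_sq_eq _ _ (gens12 k n a b c d 39) (gens12_mem_I12 k n a b c d 36) (gens12_mem_I12 k n a b c d 2)
      (gens12_mem_I12 k n a b c d 39) (by simp only [gens12, Matrix.cons_val]; ring)⟩
  · exact ⟨1, by decide, basicOpen_reesT_le_of_sq_eq _ _ (gens12 k n a b c d 20 * X c) (gens12_mem_I12 k n a b c d 37) (gens12_mem_I12 k n a b c d 1)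
      (Ideal.mul_mem_right _ _ (gens12_mem_I12 k n a b c d 20)) (by simp only [gens12, Matrix.cons_val]; ring)⟩
  · exact ⟨2, by decide, basicOpen_reesT_le_of_sq_eq _ _ (gens12 k n a b c d 20 * X c) (gens12_mem_I12 k n a b c d 38) (gens12_mem_I12 k n a b c d 2)
      (Ideal.mul_mem_right _ _ (gens12_mem_I12 k n a b c d 20)) (by simp only [gens12, Matrix.cons_val]; ring)⟩
  · exact ⟨0, by decide, basicOpen_reesT_le_of_sq_eq _ _ (gens12 k n a b c d 1 * X a) (gens12_mem_I12 k n a b c d 39) (gens12_mem_I12 k n a b c d 0)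
      (Ideal.mul_mem_right _ _ (gens12_mem_I12 k n a b c d 1)) (by simp only [gens12, Matrix.cons_val]; ring)⟩

/-- **The four vertex Rees charts cover `Bl_{I₁₂} 𝔸ⁿ`**:
`D₊(x_a³t) ∪ D₊(x_b⁴t) ∪ D₊(x_c⁶t) ∪ D₊(x_d¹²t) = Bl_{I₁₂} 𝔸ⁿ` (GW (13.19) + the certificates).
[OURS · L1 W4.5c] [folklore] -/
theorem iSup_vertexBasicOpen_eq_top :
    Proj.basicOpen (reesGrading (I12 k n a b c d))
        (reesT (gens12 k n a b c d 0) (gens12_mem_I12 k n a b c d 0)) ⊔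
      Proj.basicOpen (reesGrading (I12 k n a b c d))
        (reesT (gens12 k n a b c d 1) (gens12_mem_I12 k n a b c d 1)) ⊔
      Proj.basicOpen (reesGrading (I12 k n a b c d))
        (reesT (gens12 k n a b c d 2) (gens12_mem_I12 k n a b c d 2)) ⊔
      Proj.basicOpen (reesGrading (I12 k n a b c d))
        (reesT (gens12 k n a b c d 3) (gens12_mem_I12 k n a b c d 3)) = ⊤ := by
  -- the 40 charts cover (GW (13.19))
  have h40 : ⨆ j : Fin 40, Proj.basicOpen (reesGrading (I12 k n a b c d))
      (reesT (gens12 k n a b c d j) (gens12_mem_I12 k n a b c d j)) = ⊤ := by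
    refine Proj.iSup_basicOpen_eq_top (reesGrading (I12 k n a b c d)) _
      ((irrelevant_le_span_reesT (I12 k n a b c d)).trans ?_)
    rw [Ideal.span_le]
    rintro _ ⟨g, rfl⟩
    exact reesT_mem_span_range_reesT (gens12 k n a b c d) g.1 g.2
  refine top_le_iff.mp ?_
  rw [← h40]
  refine iSup_le fun j => ?_
  obtain ⟨i, hi, hle⟩ := exists_vertex_basicOpen_le k n a b c d j
  refine hle.trans ?_
  rcases hi with rfl | rfl | rfl | rfl
  · exact le_sup_left.trans (le_sup_left.trans le_sup_left)
  · exact le_sup_right.trans (le_sup_left.trans le_sup_left)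
  · exact le_sup_right.trans le_sup_left
  · exact le_sup_right

/-- **lead-1's principal chart `chart j = V[g_j]` is the Rees chart `D₊(g_j t)`** (p506419
`blowupChart_affineBlowup_eq_basicOpen_reesT`). [OURS · L1 W4.5c] -/
theorem chart_eq_basicOpen (j : Fin 40) :
    chart k n a b c d j = Proj.basicOpen (reesGrading (I12 k n a b c d))
      (reesT (gens12 k n a b c d j) (gens12_mem_I12 k n a b c d j)) :=
  ToricExit.blowupChart_affineBlowup_eq_basicOpen_reesT _ _

/-- **The four VERTEX CHARTS cover `Bl_{I₁₂} 𝔸ⁿ`: `chart 0 ⊔ chart 1 ⊔ chart 2 ⊔ chart 3 = ⊤`**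
(`V[x_a³] ∪ V[x_b⁴] ∪ V[x_c⁶] ∪ V[x_d¹²]`; step 1 of `Hcov`). [OURS · L1 W4.5c] [folklore] -/
theorem iSup_vertexCharts_eq_top :
    chart k n a b c d 0 ⊔ chart k n a b c d 1 ⊔ chart k n a b c d 2 ⊔ chart k n a b c d 3 = ⊤ := by
  rw [chart_eq_basicOpen, chart_eq_basicOpen, chart_eq_basicOpen, chart_eq_basicOpen]
  exact iSup_vertexBasicOpen_eq_top k n a b c d

end Summit.ResolutionOfSingularities.ResolutionOfSingularities.Theorems.WildQuotientResolution.JordanFive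

end
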